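import Literature.Computability.Complexity.TokenStreams
import Literature.Computability.QuantumComplexity.RevTableau
import Literature.Computability.Cryptography.QuantumCircuit
import Literature.Computability.Cryptography.QuantumCircuitDescFP
import HarnessLib

/-!
# Uniform reversible simulation of `FinTM2` deciders: uniformity of the tableau family

Sequel of `RevTableau.lean` (trunk CryptoQuantFine; the reversible core of `P ⊆ EQP ⊆ BQP`,
Bernstein–Vazirani 1997, Thm. 8.2; Arora–Barak 2009, §10.3.7, Lemma 10.10 with Thm. 6.6). There
the explicit reversible program `RevSim.allOps e M n` (wires indexed by closed affine
expressions in `n`, the step `t` and the cell `j`) and its Clifford+T compilation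
`RevSim.revFamily e M` were constructed and proved correct. Here we prove that the family is
**polynomial-time uniform** (`RevSim.revFamily_isUniform`): a `TM2` machine prints
`QCircuit.sigmaEncode ⟨n, ancN n, circ n⟩` from `1ⁿ` in polynomial time. Following Arora–Barak
(§6.2 and the proof of Thm. 6.15: "output the description gate by gate, keeping counters"), no
machine is written by hand: the description is the rendered stream of a *generator program*
(`GenPrograms.lean`: literal emission inside nested counted loops with polynomial bounds;
`TokenStreams.lean`: binary numerals of unary-counted quantities, `GStmt.render_out_mem_FP`),
and the whole proof is a list identity.

* `RevDesc.gateBits`, `RevDesc.opBits`, `RevDesc.encode_eq_flatMap` (bit doubling is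
  `Literature.Computability.Complexity.SProg.dbl` of `StackMachines.lean`),
  `RevDesc.flatMap_gateEnc_revCompile_toRevList` — the description of a compiled re-indexed
  `NOT`/`CNOT`/Toffoli program (`toRevList`, `revCompile`: `X = HSSH`, Toffoli `= H·CCZ·H`) is
  the concatenation, gate by gate, of fixed bit patterns around the binary numerals of the wire
  indices (`QGate.encode`, `boolPair`, `encodingListNatBool`);
* `RevDesc.opToks`, `RevDesc.render_flatMap_opToks` — the same as token streams;
* `RevSim.GV`, `RevSim.TnE` … `RevSim.ancNE` — the layout quantities of `RevTableau.lean` as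
  counter expressions (`GExpr`) with their values (`eval_cellWE`, …);
* `RevSim.stepG`, `RevSim.inputG`, `RevSim.outputG`, `RevSim.headerG`, `RevSim.descG` — the
  generator, mirroring `stepOps`/`inputOps`/`outputOps`/`allOps` loop by loop (the `j`-loop over
  the cells is unrolled below `2d`, where the gadget `cellOp` depends on `j`, and uniform above);
  `out_stepG`, `out_inputG`, `out_descG` — it prints the header and the program tokens;
  `render_out_descG` — **the rendered stream is `sigmaEncode` of the `n`-th circuit**;
* `QCircuitFamily.isUniform_of_mem_FP` — uniformity from membership of the description
  function in `FP`; `RevSim.revFamily_isUniform` — **the tableau family is uniform**.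

With `revEval_revProg_zero` (`RevTableau.lean`) and `mem_EQP_of_basisOutput`
(`Cryptography/ClassBQPProofs.lean`) this discharges the uniform reversible core
`uniformReversibleDecider`, hence `P ⊆ EQP ⊆ BQP`.

## References

* E. Bernstein, U. Vazirani, *Quantum complexity theory*, SIAM J. Comput. 26 (1997)
  1411–1473, §8.2, Thm. 8.2 (`P ⊆ EQP`), p. 1451.
* S. Arora, B. Barak, *Computational Complexity: A Modern Approach*, CUP 2009, §0.1
  (representations), §6.1–6.2 (circuit descriptions, P-uniform families), Thm. 6.6, proof of
  Thm. 6.15 ("keeping counters"); §10.3.7, Lemma 10.10.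
* M. A. Nielsen, I. L. Chuang, *Quantum Computation and Quantum Information*, CUP 2010, §4.3,
  Fig. 4.9 (Toffoli from `H, S, T, CNOT`), §4.5.5 (uniform families).
-/

/-! ## Descriptions of compiled reversible programs as bit and token streams -/

namespace Literature.Computability.QuantumComplexity

open _root_.Computability Complexity Cryptography

namespace RevDesc

/-! ### Bit patterns of gate descriptions -/

-- Doubling every bit, `dbl` (the first component of `boolPair`), is `Literature.Computability.Complexity.SProg.dbl`
-- of `StackMachines.lean` (with `dbl_nil`, `dbl_cons`, `length_dbl`).
open Complexity.SProg (dbl dbl_nil dbl_cons)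

/-- `dbl` of a concatenation. [folklore] -/
@[simp] theorem dbl_append (as bs : List Bool) : dbl (as ++ bs) = dbl as ++ dbl bs := by
  simp [dbl, List.flatMap_append]
/-- `dbl` of a constant run. [folklore] -/
@[simp] theorem dbl_replicate (m : ℕ) (b : Bool) : dbl (List.replicate m b) = List.replicate (2 * m) b := by
  induction m with
  | zero => rfl
  | succ m ih => rw [List.replicate_succ, dbl_cons, ih, show 2 * (m + 1) = 2 * m + 1 + 1 by ring,
      List.replicate_succ, List.replicate_succ]
/-- `boolPair` in terms of `dbl`. [Arora–Barak 2009, §0.1] [folklore] -/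
theorem boolPair_eq (x y : List Bool) : boolPair x y = dbl x ++ [false, true] ++ y := rfl
/-- Doubling twice is quadrupling, i.e. `Tok.numeral 4` on numerals. [folklore] -/
theorem dbl_dbl_eq_flatMap (bs : List Bool) : dbl (dbl bs) = bs.flatMap fun b => [b, b, b, b] := by
  induction bs with
  | nil => rfl
  | cons b bs ih => simp [ih]
/-- `dbl (dbl (encodeNat w))` is the numeral of `w` with bit multiplicity `4`. [folklore] -/
theorem dbl_dbl_encodeNat (w : ℕ) : dbl (dbl (encodeNat w)) = Tok.numeral 4 w := by
  rw [dbl_dbl_eq_flatMap]; rfl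
/-- `dbl (encodeNat n)` is the numeral of `n` with bit multiplicity `2`. [folklore] -/
theorem dbl_encodeNat (n : ℕ) : dbl (encodeNat n) = Tok.numeral 2 n := rfl
/-- `unaryEncodeNat m = 1^m`. [folklore] -/
theorem unaryEncodeNat_eq_replicate : ∀ m : ℕ, unaryEncodeNat m = List.replicate m true
  | 0 => rfl
  | m + 1 => by rw [unaryEncodeNat, unaryEncodeNat_eq_replicate m, List.replicate_succ]

/-- The description bits of one wire index inside a doubled gate description:
`x4 (encodeNat w) ++ 0011`. [Arora–Barak 2009, §0.1, §6.1] [folklore] -/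
def wireBits (w : ℕ) : List Bool := Tok.numeral 4 w ++ [false, false, true, true]

/-- The constant prefix of a doubled gate description: tag, symbol code `s`, arity `a` in unary.
[Arora–Barak 2009, §6.1] [folklore] -/
def gatePre (s a : ℕ) : List Bool :=
  [false, false] ++ dbl (dbl (encodeNat s)) ++ [false, false, true, true] ++
    List.replicate (4 * a) true ++ [false, false, true, true]

/-- The contribution of one placed gate with symbol code `s`, arity `a` and wires `ws` to the
description of a circuit (`QCircuit.encode`): `dbl (gate code) ++ 01`. [Arora–Barak 2009, §6.1]
[folklore] -/
def gateBits (s a : ℕ) (ws : List ℕ) : List Bool := gatePre s a ++ ws.flatMap wireBits ++ [false, true]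

/-- The contribution of one placed gate to `QCircuit.encode`. [Arora–Barak 2009, §6.1]
[folklore] -/
def gateEnc {G : QGateSet} [Encodable G.Op] {N : ℕ} (g : QGate G N) : List Bool :=
  dbl g.encode ++ [false, true]

/-- **`QCircuit.encode` is the concatenation of the gate contributions.** [Arora–Barak 2009,
§6.1] [folklore] -/
theorem encode_eq_flatMap {G : QGateSet} [Encodable G.Op] {N : ℕ} (gs : List (QGate G N)) :
    QCircuit.encode (⟨gs⟩ : QCircuit G N) = gs.flatMap gateEnc := by
  unfold QCircuit.encode
  induction gs with
  | nil => rfl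
  | cons g gs ih =>
    rw [List.foldr_cons, List.flatMap_cons, boolPair_eq]
    change dbl g.encode ++ [false, true] ++ QCircuit.encode (⟨gs⟩ : QCircuit G N) = _
    rw [show QCircuit.encode (⟨gs⟩ : QCircuit G N) = _ from ih, gateEnc, List.append_assoc]

/-- The doubled inner list encoding of wire indices. [folklore] -/
theorem dbl_foldr_boolPair (ws : List ℕ) :
    dbl (ws.foldr (fun a acc => boolPair (encodeNat a) acc) []) = ws.flatMap wireBits := by
  induction ws with
  | nil => rfl
  | cons w ws ih =>
    rw [List.foldr_cons, boolPair_eq, dbl_append, dbl_append, ih, List.flatMap_cons, wireBits,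
      dbl_dbl_encodeNat]
    simp

/-- **The contribution of a placed gate of a gate set**: symbol code, arity in unary, wires in
binary. [Arora–Barak 2009, §6.1] [folklore] -/
theorem gateEnc_gate {G : QGateSet} [Encodable G.Op] {N : ℕ} (g : G.Op) (emb : Fin (G.arity g) ↪ Fin N) :
    gateEnc (QGate.gate g emb : QGate G N) =
      gateBits (Encodable.encode g) (G.arity g) (List.ofFn fun i => (emb i : ℕ)) := by
  simp only [gateEnc, QGate.encode, gateBits, gatePre]
  rw [boolPair_eq]
  change dbl (false :: (dbl (encodeNat (Encodable.encode g)) ++ [false, true] ++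
    boolPair (unaryEncodeNat (List.ofFn fun i => (emb i : ℕ)).length)
      ((List.ofFn fun i => (emb i : ℕ)).foldr (fun a acc => boolPair (encodeNat a) acc) []))) ++
    [false, true] = _
  rw [boolPair_eq, List.length_ofFn, unaryEncodeNat_eq_replicate]
  simp only [dbl_cons, dbl_append, dbl_replicate, dbl_foldr_boolPair]
  simp [show 2 * (2 * G.arity g) = 4 * G.arity g by ring]

/-- Symbol codes of Clifford+T (`Encodable CliffordTOp` via `Fin 4`). [folklore] -/
theorem encode_cliffordT_H : Encodable.encode CliffordTOp.H = 0 := rfl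
/-- Symbol code of `S`. [folklore] -/
theorem encode_cliffordT_S : Encodable.encode CliffordTOp.S = 1 := rfl
/-- Symbol code of `T`. [folklore] -/
theorem encode_cliffordT_T : Encodable.encode CliffordTOp.T = 2 := rfl
/-- Symbol code of `CNOT`. [folklore] -/
theorem encode_cliffordT_CNOT : Encodable.encode CliffordTOp.CNOT = 3 := rfl

/-- Description of a placed `H`. [folklore] -/
theorem gateEnc_hOn {N : ℕ} (i : Fin N) : gateEnc (hOn i) = gateBits 0 1 [i.val] := by
  rw [hOn, gateEnc_gate]; rfl
/-- Description of a placed `S`. [folklore] -/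
theorem gateEnc_sOn {N : ℕ} (i : Fin N) : gateEnc (sOn i) = gateBits 1 1 [i.val] := by
  rw [sOn, gateEnc_gate]; rfl
/-- Description of a placed `T`. [folklore] -/
theorem gateEnc_tOn {N : ℕ} (i : Fin N) : gateEnc (tOn i) = gateBits 2 1 [i.val] := by
  rw [tOn, gateEnc_gate]; rfl
/-- Description of a placed `CNOT`. [folklore] -/
theorem gateEnc_cnotOn {N : ℕ} (i j : Fin N) (h : i ≠ j) : gateEnc (cnotOn i j h) = gateBits 3 2 [i.val, j.val] := by
  rw [cnotOn, gateEnc_gate]; rfl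

/-! ### Abstract Clifford+T words of the reversible gates -/

/-- A Clifford+T gate symbol with its wires in an arbitrary index type. [folklore] -/
structure AGate (α : Type) where
  /-- the gate symbol -/
  sym : CliffordTOp
  /-- its wires -/
  wires : List α

/-- Re-indexing the wires. [folklore] -/
def AGate.map {α β : Type} (f : α → β) (g : AGate α) : AGate β := ⟨g.sym, g.wires.map f⟩

/-- The symbol code (`Encodable CliffordTOp`). [folklore] -/
def symCode : CliffordTOp → ℕ
  | .H => 0 | .S => 1 | .T => 2 | .CNOT => 3

/-- The arity (`cliffordT.arity`). [folklore] -/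
def symArity : CliffordTOp → ℕ
  | .CNOT => 2 | _ => 1

/-- The description bits of an abstract gate. [folklore] -/
def AGate.bits (g : AGate ℕ) : List Bool := gateBits (symCode g.sym) (symArity g.sym) g.wires

/-- **The Clifford+T words of the reversible gates, abstractly** (`RevOp.compile`: `X = HSSH`,
`CNOT`, Toffoli `= H · CCZ-word · H`, Nielsen–Chuang 2010, Fig. 4.9). [cite: NielsenChuang2010, §4.3 Fig. 4.9] -/
def agates {α : Type} : ClOp α → List (AGate α)
  | .not i => [⟨.H, [i]⟩, ⟨.S, [i]⟩, ⟨.S, [i]⟩, ⟨.H, [i]⟩]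
  | .cnot i j => [⟨.CNOT, [i, j]⟩]
  | .toffoli a b c =>
    [⟨.H, [c]⟩, ⟨.T, [a]⟩, ⟨.T, [b]⟩, ⟨.T, [c]⟩, ⟨.CNOT, [a, b]⟩, ⟨.S, [b]⟩, ⟨.S, [b]⟩, ⟨.S, [b]⟩,
      ⟨.T, [b]⟩, ⟨.CNOT, [b, c]⟩, ⟨.T, [c]⟩, ⟨.CNOT, [a, c]⟩, ⟨.S, [c]⟩, ⟨.S, [c]⟩, ⟨.S, [c]⟩,
      ⟨.T, [c]⟩, ⟨.CNOT, [b, c]⟩, ⟨.S, [c]⟩, ⟨.S, [c]⟩, ⟨.S, [c]⟩, ⟨.T, [c]⟩, ⟨.CNOT, [a, c]⟩,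
      ⟨.CNOT, [a, b]⟩, ⟨.H, [c]⟩]

/-- `agates` commutes with re-indexing. [folklore] -/
theorem agates_map {α β : Type} (f : α → β) (op : ClOp α) :
    agates (op.map f) = (agates op).map (AGate.map f) := by
  cases op <;> rfl

/-- The description bits of the compiled word of a reversible gate on `ℕ`-indexed wires.
[folklore] -/
def opBits (op : ClOp ℕ) : List Bool := (agates op).flatMap AGate.bits

/-- **The compiled word of a re-indexed well-formed gate describes as `opBits`**: for wires
below `N`, `finOf N` is the identity on values. [folklore] -/
theorem flatMap_gateEnc_compile_toRev {N : ℕ} (hN : 0 < N) (op : ClOp ℕ)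
    (hlt : ∀ i ∈ RevSim.wiresOf op, i < N) (h : (op.map (RevSim.finOf N hN)).WF) :
    ((op.map (RevSim.finOf N hN)).toRev h).compile.flatMap gateEnc = opBits op := by
  cases op with
  | not i =>
    have hi : (RevSim.finOf N hN i : ℕ) = i := RevSim.val_finOf_of_lt hN (hlt i (by simp [RevSim.wiresOf, ClOp.target, ClOp.controls]))
    simp [ClOp.map, ClOp.toRev, RevOp.compile, xWord, gateEnc_hOn, gateEnc_sOn, opBits, agates,
      AGate.bits, symCode, symArity, hi]
  | cnot i j =>
    have hi : (RevSim.finOf N hN i : ℕ) = i := RevSim.val_finOf_of_lt hN (hlt i (by simp [RevSim.wiresOf, ClOp.target, ClOp.controls]))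
    have hj : (RevSim.finOf N hN j : ℕ) = j := RevSim.val_finOf_of_lt hN (hlt j (by simp [RevSim.wiresOf, ClOp.target, ClOp.controls]))
    simp [ClOp.map, ClOp.toRev, RevOp.compile, gateEnc_cnotOn, opBits, agates, AGate.bits, symCode,
      symArity, hi, hj]
  | toffoli a b c =>
    have ha : (RevSim.finOf N hN a : ℕ) = a := RevSim.val_finOf_of_lt hN (hlt a (by simp [RevSim.wiresOf, ClOp.target, ClOp.controls]))
    have hb : (RevSim.finOf N hN b : ℕ) = b := RevSim.val_finOf_of_lt hN (hlt b (by simp [RevSim.wiresOf, ClOp.target, ClOp.controls]))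
    have hc : (RevSim.finOf N hN c : ℕ) = c := RevSim.val_finOf_of_lt hN (hlt c (by simp [RevSim.wiresOf, ClOp.target, ClOp.controls]))
    simp [ClOp.map, ClOp.toRev, RevOp.compile, toffoliWord, cczWord, gateEnc_hOn, gateEnc_sOn,
      gateEnc_tOn, gateEnc_cnotOn, opBits, agates, AGate.bits, symCode, symArity, ha, hb, hc]

/-- **The description of a compiled re-indexed program is the concatenation of the `opBits`.**
[Arora–Barak 2009, §6.1; §10.3.7 Lemma 10.10] [folklore] -/
theorem flatMap_gateEnc_revCompile_toRevList {N : ℕ} (hN : 0 < N) :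
    ∀ (ops : List (ClOp ℕ)) (_ : ∀ op ∈ ops, ∀ i ∈ RevSim.wiresOf op, i < N)
      (h : ∀ op ∈ ops.map (ClOp.map (RevSim.finOf N hN)), op.WF),
    (revCompile (toRevList (ops.map (ClOp.map (RevSim.finOf N hN))) h)).flatMap gateEnc =
      ops.flatMap opBits
  | [], _, _ => rfl
  | op :: ops, hlt, h => by
    change (revCompile ((op.map (RevSim.finOf N hN)).toRev _ ::
      toRevList (ops.map (ClOp.map (RevSim.finOf N hN))) _)).flatMap gateEnc = _
    rw [revCompile_cons, List.flatMap_append, List.flatMap_cons,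
      flatMap_gateEnc_compile_toRev hN op (hlt op (by simp)),
      flatMap_gateEnc_revCompile_toRevList hN ops (fun o ho => hlt o (by simp [ho]))]

/-! ### Token streams of gate descriptions -/

/-- Literal tokens of a bit word. [folklore] -/
def litT (bs : List Bool) : List Tok := bs.map Tok.lit

/-- The tokens of one wire index: `w` ticks, a dump with multiplicity `4`, the separator.
[folklore] -/
def wireToks (w : ℕ) : List Tok :=
  List.replicate w Tok.tick ++ Tok.dump true true :: litT [false, false, true, true]

/-- The tokens of one placed gate. [folklore] -/
def gateToks (s a : ℕ) (ws : List ℕ) : List Tok := litT (gatePre s a) ++ ws.flatMap wireToks ++ litT [false, true]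

/-- The tokens of an abstract gate. [folklore] -/
def AGate.toks (g : AGate ℕ) : List Tok := gateToks (symCode g.sym) (symArity g.sym) g.wires

/-- The tokens of the compiled word of a reversible gate. [folklore] -/
def opToks (op : ClOp ℕ) : List Tok := (agates op).flatMap AGate.toks

/-- Literal tokens render verbatim. [folklore] -/
theorem render_litT (c : ℕ) (bs : List Bool) (B : List Tok) : Tok.render c (litT bs ++ B) = bs ++ Tok.render c B :=
  Tok.render_map_lit c bs B
/-- Literal tokens keep the counter. [folklore] -/
theorem fin_litT (c : ℕ) (bs : List Bool) (B : List Tok) : Tok.fin c (litT bs ++ B) = Tok.fin c B :=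
  Tok.fin_map_lit c bs B

/-- Wire tokens render to wire bits (from counter `0`). [folklore] -/
theorem render_wireToks (w : ℕ) (B : List Tok) : Tok.render 0 (wireToks w ++ B) = wireBits w ++ Tok.render 0 B := by
  rw [wireToks, List.append_assoc, List.cons_append, Tok.render_numeral, render_litT, wireBits,
    List.append_assoc]
  rfl
/-- Wire tokens reset the counter. [folklore] -/
theorem fin_wireToks (c w : ℕ) (B : List Tok) : Tok.fin c (wireToks w ++ B) = Tok.fin 0 B := by
  rw [wireToks, List.append_assoc, List.cons_append, Tok.fin_numeral, fin_litT]

/-- Lists of wire tokens render to lists of wire bits. [folklore] -/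
theorem render_flatMap_wireToks (ws : List ℕ) (B : List Tok) :
    Tok.render 0 (ws.flatMap wireToks ++ B) = ws.flatMap wireBits ++ Tok.render 0 B := by
  induction ws with
  | nil => rfl
  | cons w ws ih => rw [List.flatMap_cons, List.append_assoc, render_wireToks, ih, List.flatMap_cons,
      List.append_assoc]

/-- Lists of wire tokens reset the counter (from `0`). [folklore] -/
theorem fin_flatMap_wireToks (ws : List ℕ) (B : List Tok) : Tok.fin 0 (ws.flatMap wireToks ++ B) = Tok.fin 0 B := by
  induction ws with
  | nil => rfl
  | cons w ws ih => rw [List.flatMap_cons, List.append_assoc, fin_wireToks, ih]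

/-- Gate tokens render to gate bits. [folklore] -/
theorem render_gateToks (s a : ℕ) (ws : List ℕ) (B : List Tok) :
    Tok.render 0 (gateToks s a ws ++ B) = gateBits s a ws ++ Tok.render 0 B := by
  rw [gateToks, List.append_assoc, List.append_assoc, render_litT, render_flatMap_wireToks,
    render_litT, gateBits, List.append_assoc, List.append_assoc]

/-- Gate tokens reset the counter (from `0`). [folklore] -/
theorem fin_gateToks (s a : ℕ) (ws : List ℕ) (B : List Tok) : Tok.fin 0 (gateToks s a ws ++ B) = Tok.fin 0 B := by
  rw [gateToks, List.append_assoc, List.append_assoc, fin_litT, fin_flatMap_wireToks, fin_litT]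

/-- Abstract-gate tokens render to abstract-gate bits. [folklore] -/
theorem render_flatMap_toks (gs : List (AGate ℕ)) (B : List Tok) :
    Tok.render 0 (gs.flatMap AGate.toks ++ B) = gs.flatMap AGate.bits ++ Tok.render 0 B := by
  induction gs with
  | nil => rfl
  | cons g gs ih => rw [List.flatMap_cons, List.append_assoc, AGate.toks, render_gateToks, ih,
      List.flatMap_cons, AGate.bits, List.append_assoc]

/-- Abstract-gate tokens reset the counter. [folklore] -/
theorem fin_flatMap_toks (gs : List (AGate ℕ)) (B : List Tok) : Tok.fin 0 (gs.flatMap AGate.toks ++ B) = Tok.fin 0 B := by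
  induction gs with
  | nil => rfl
  | cons g gs ih => rw [List.flatMap_cons, List.append_assoc, AGate.toks, fin_gateToks, ih]

/-- **Program tokens render to the program description.** [folklore] -/
theorem render_flatMap_opToks (ops : List (ClOp ℕ)) (B : List Tok) :
    Tok.render 0 (ops.flatMap opToks ++ B) = ops.flatMap opBits ++ Tok.render 0 B := by
  induction ops with
  | nil => rfl
  | cons op ops ih => rw [List.flatMap_cons, List.append_assoc, opToks, render_flatMap_toks,
      ih, List.flatMap_cons, opBits, List.append_assoc]

/-- Program tokens reset the counter. [folklore] -/
theorem fin_flatMap_opToks (ops : List (ClOp ℕ)) (B : List Tok) : Tok.fin 0 (ops.flatMap opToks ++ B) = Tok.fin 0 B := by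
  induction ops with
  | nil => rfl
  | cons op ops ih => rw [List.flatMap_cons, List.append_assoc, opToks, fin_flatMap_toks, ih]

end RevDesc

end Literature.Computability.QuantumComplexity
/-! ## The generator program of the tableau family and its uniformity -/

namespace Literature.Computability.QuantumComplexity

open _root_.Computability Complexity Complexity.FinTM2Sim Turing Cryptography RevDesc
open Complexity.SProg (dbl dbl_nil dbl_cons)

namespace RevSim

attribute [local instance] Turing.FinTM2.kFin Turing.FinTM2.ΛFin Turing.FinTM2.σFin
  Turing.FinTM2.Γk₀Fin

/-! ### Generator programs: generic combinators -/

/-- The loop and counter variables of the generator: the input length `n`, the step `t`,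
the cell `j`, the tick counter `i`, the filler counter `u`. [folklore] -/
inductive GV where
  | xn | tt | jj | ii | uu
  deriving DecidableEq, Fintype, Repr

/-- Counter expressions of the generator. [folklore] -/
abbrev GE : Type := GExpr GV

/-- Generator statements over the token alphabet. [folklore] -/
abbrev GS : Type := GStmt GV Tok

attribute [local simp] GExpr.eval

/-- Powers as iterated products. [folklore] -/
def GE.pw (a : GE) : ℕ → GE
  | 0 => .const 1
  | m + 1 => .mul (GE.pw a m) a

/-- The value of a power expression. [folklore] -/
@[simp] theorem GE.eval_pw (env : GV → ℕ) (a : GE) : ∀ m : ℕ, (GE.pw a m).eval env = (a.eval env) ^ m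
  | 0 => by simp [GE.pw]
  | m + 1 => by simp [GE.pw, GE.eval_pw env a m, pow_succ]

/-- Sequencing a list of statements. [folklore] -/
def seqs {V Γ : Type} : List (GStmt V Γ) → GStmt V Γ
  | [] => .emit []
  | s :: l => .seq s (seqs l)

/-- The stream of a sequence is the concatenation of the streams. [folklore] -/
@[simp] theorem out_seqs {V Γ : Type} [DecidableEq V] (env : V → ℕ) :
    ∀ l : List (GStmt V Γ), (seqs l).out env = l.flatMap fun s => s.out env
  | [] => rfl
  | s :: l => by rw [seqs, GStmt.out, out_seqs env l, List.flatMap_cons]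

/-- The loop variables of a sequence. [folklore] -/
@[simp] theorem loopVars_seqs {V Γ : Type} : ∀ l : List (GStmt V Γ), (seqs l).loopVars = l.flatMap GStmt.loopVars
  | [] => rfl
  | s :: l => by rw [seqs, GStmt.loopVars, loopVars_seqs l, List.flatMap_cons]

/-- A sequence of non-reusing statements is non-reusing. [folklore] -/
theorem noReuse_seqs {V Γ : Type} [DecidableEq V] :
    ∀ l : List (GStmt V Γ), (∀ s ∈ l, s.noReuse = true) → (seqs l).noReuse = true
  | [], _ => rfl
  | s :: l, h => by
    rw [seqs, GStmt.noReuse, h s (by simp), noReuse_seqs l (fun s' hs' => h s' (by simp [hs'])), Bool.and_self]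

/-- A constant singleton stream repeated is a constant run. [folklore] -/
theorem flatMap_range_const {α : Type} (a : α) : ∀ m : ℕ, ((List.range m).flatMap fun _ => [a]) = List.replicate m a
  | 0 => rfl
  | m + 1 => by
    rw [List.range_succ, List.flatMap_append, flatMap_range_const a m, List.flatMap_singleton,
      List.replicate_succ']

/-- `w` ticks. [folklore] -/
def ticksG (w : GE) : GS := .loop .ii w (.emit [Tok.tick])

/-- The stream of `ticksG`. [folklore] -/
@[simp] theorem out_ticksG (w : GE) (env : GV → ℕ) : (ticksG w).out env = List.replicate (w.eval env) Tok.tick := by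
  simp [ticksG, GStmt.out, flatMap_range_const]

/-- One wire index: ticks, dump, separator. [folklore] -/
def wireG (w : GE) : GS := .seq (ticksG w) (.emit (Tok.dump true true :: litT [false, false, true, true]))

/-- The stream of `wireG`. [folklore] -/
@[simp] theorem out_wireG (w : GE) (env : GV → ℕ) : (wireG w).out env = wireToks (w.eval env) := by
  simp [wireG, GStmt.out, wireToks]

/-- One abstract gate. [folklore] -/
def agateG (g : AGate GE) : GS :=
  .seq (.emit (litT (gatePre (symCode g.sym) (symArity g.sym))))
    (.seq (seqs (g.wires.map wireG)) (.emit (litT [false, true])))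

/-- The stream of `agateG`. [folklore] -/
@[simp] theorem out_agateG (g : AGate GE) (env : GV → ℕ) :
    (agateG g).out env = (g.map (GExpr.eval env)).toks := by
  simp [agateG, GStmt.out, AGate.toks, AGate.map, gateToks, List.flatMap_map]

/-- One reversible gate: its Clifford+T word. [folklore] -/
def opG (op : ClOp GE) : GS := seqs ((agates op).map agateG)

/-- The stream of `opG`. [folklore] -/
@[simp] theorem out_opG (op : ClOp GE) (env : GV → ℕ) : (opG op).out env = opToks (op.map (GExpr.eval env)) := by
  simp [opG, opToks, agates_map, List.flatMap_map]

/-- A list of reversible gates. [folklore] -/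
def opsG (ops : List (ClOp GE)) : GS := seqs (ops.map opG)

/-- The stream of `opsG`. [folklore] -/
@[simp] theorem out_opsG (ops : List (ClOp GE)) (env : GV → ℕ) :
    (opsG ops).out env = (ops.map (ClOp.map (GExpr.eval env))).flatMap opToks := by
  simp [opsG, List.flatMap_map]

/-- The only loop variable of `wireG` is the tick counter. [folklore] -/
theorem loopVars_wireG (w : GE) : (wireG w).loopVars = [.ii] := rfl

/-- The loop variables of `opsG` are tick counters. [folklore] -/
theorem loopVars_opsG_sub (ops : List (ClOp GE)) : ∀ x ∈ (opsG ops).loopVars, x = GV.ii := by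
  intro x hx
  simp only [opsG, loopVars_seqs, List.flatMap_map, List.mem_flatMap, opG, agateG, GStmt.loopVars,
    List.nil_append, List.append_nil, loopVars_wireG] at hx
  obtain ⟨_, _, _, _, _, _, hx⟩ := hx
  simpa using hx

/-- `opsG` does not reuse loop variables. [folklore] -/
theorem noReuse_opsG (ops : List (ClOp GE)) : (opsG ops).noReuse = true := by
  refine noReuse_seqs _ fun s hs => ?_
  simp only [List.mem_map] at hs
  obtain ⟨op, _, rfl⟩ := hs
  refine noReuse_seqs _ fun s hs => ?_
  simp only [List.mem_map] at hs
  obtain ⟨g, _, rfl⟩ := hs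
  simp only [agateG, GStmt.noReuse, Bool.true_and, Bool.and_true]
  refine noReuse_seqs _ fun s hs => ?_
  simp only [List.mem_map] at hs
  obtain ⟨w, _, rfl⟩ := hs
  rfl

/-! ### The layout as counter expressions -/

section LayoutE

variable (tm : FinTM2) (e : ℕ)

/-- `T(n) = (n+2)^e` [folklore] -/
def TnE : GE := GE.pw (.add (.var .xn) (.const 2)) e

/-- `S(n)` [folklore] -/
noncomputable def SnE : GE := .add (.add (.var .xn) (.mul (.const (dd tm)) (TnE e))) (.const (2 * dd tm))

/-- layer width [folklore] -/
noncomputable def LWE : GE := .add (.const (nC tm)) (.mul (.add (SnE tm e) (.const (dd tm))) (.const (CW tm)))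

/-- period [folklore] -/
noncomputable def PPE : GE := .add (LWE tm e) (.const (RW tm))

/-- base of layer `t` [folklore] -/
noncomputable def LBE (tE : GE) : GE := .add (.var .xn) (.mul tE (PPE tm e))

/-- control wire [folklore] -/
noncomputable def ctrlWE (tE : GE) (q : Ctrl tm) : GE := .add (LBE tm e tE) (.const (eC tm q))

/-- cell wire [folklore] -/
noncomputable def cellWE (tE jE : GE) (ka : KA tm) : GE :=
  .add (.add (.add (LBE tm e tE) (.const (nC tm))) (.mul jE (.const (CW tm)))) (.const (eKA tm ka))

/-- chain ancilla [folklore] -/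
noncomputable def ancWE (tE : GE) (v : V tm) (m : ℕ) : GE :=
  .add (.add (LBE tm e tE) (LWE tm e)) (.const (eV tm v * rr tm + m))

/-- decision wire [folklore] -/
noncomputable def deltaWE (tE : GE) (v : V tm) : GE := ancWE tm e tE v (rr tm - 1)

/-- answer wire [folklore] -/
noncomputable def ansWE : GE := .add (LBE tm e (TnE e)) (LWE tm e)

/-- number of ancillas [folklore] -/
noncomputable def ancNE : GE := .add (.add (.mul (TnE e) (PPE tm e)) (LWE tm e)) (.const 1)

variable (env : GV → ℕ)

/-- value of `TnE` [folklore] -/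
@[simp] theorem eval_TnE : (TnE e).eval env = Tn e (env .xn) := by simp [TnE, Tn]
/-- value of `SnE` [folklore] -/
@[simp] theorem eval_SnE : (SnE tm e).eval env = Sn tm e (env .xn) := by simp [SnE, Sn]
/-- value of `LWE` [folklore] -/
@[simp] theorem eval_LWE : (LWE tm e).eval env = LW tm e (env .xn) := by simp [LWE, LW]
/-- value of `PPE` [folklore] -/
@[simp] theorem eval_PPE : (PPE tm e).eval env = PP tm e (env .xn) := by simp [PPE, PP]
/-- value of `LBE` [folklore] -/
@[simp] theorem eval_LBE (tE : GE) : (LBE tm e tE).eval env = LB tm e (env .xn) (tE.eval env) := by simp [LBE, LB]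
/-- value of `ctrlWE` [folklore] -/
@[simp] theorem eval_ctrlWE (tE : GE) (q : Ctrl tm) :
    (ctrlWE tm e tE q).eval env = ctrlW tm e (env .xn) (tE.eval env) q := by simp [ctrlWE, ctrlW]
/-- value of `cellWE` [folklore] -/
@[simp] theorem eval_cellWE (tE jE : GE) (ka : KA tm) :
    (cellWE tm e tE jE ka).eval env = cellW tm e (env .xn) (tE.eval env) (jE.eval env) ka := by
  simp [cellWE, cellW]
/-- value of `ancWE` [folklore] -/
@[simp] theorem eval_ancWE (tE : GE) (v : V tm) (m : ℕ) :
    (ancWE tm e tE v m).eval env = ancW tm e (env .xn) (tE.eval env) v m := by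
  simp [ancWE, ancW, RB]; ring
/-- value of `deltaWE` [folklore] -/
@[simp] theorem eval_deltaWE (tE : GE) (v : V tm) :
    (deltaWE tm e tE v).eval env = deltaW tm e (env .xn) (tE.eval env) v := by
  simp [deltaWE, deltaW]
/-- value of `ansWE` [folklore] -/
@[simp] theorem eval_ansWE : (ansWE tm e).eval env = ansW tm e (env .xn) := by simp [ansWE, ansW]
/-- value of `ancNE` [folklore] -/
@[simp] theorem eval_ancNE : (ancNE tm e).eval env = ancN tm e (env .xn) := by simp [ancNE, ancN]

end LayoutE

/-! ### The gadgets as generator programs -/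

section GadgetsE

variable (tm : FinTM2) (e : ℕ)

/-- literal wires of a chain, as expressions [folklore] -/
noncomputable def litsE (tE : GE) (v : V tm) : List GE :=
  (List.finRange (dd tm)).flatMap fun m : Fin (dd tm) =>
    (kList tm).map fun k => cellWE tm e tE (.const (m : ℕ)) ⟨k, v.2 m k⟩

/-- ancillas of a chain, as expressions [folklore] -/
noncomputable def ancsE (tE : GE) (v : V tm) : List GE :=
  (List.range (rr tm)).map fun m => ancWE tm e tE v m

/-- the chain of a view, as expressions [folklore] -/
noncomputable def chainOpsE (tE : GE) (v : V tm) : List (ClOp GE) :=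
  clChain (ctrlWE tm e tE v.1) (litsE tm e tE v) (ancsE tm e tE v)

/-- the new control, as expressions [folklore] -/
noncomputable def ctrlOpsE (tE : GE) (v : V tm) : List (ClOp GE) :=
  [ClOp.cnot (deltaWE tm e tE v) (ctrlWE tm e (.add tE (.const 1)) (newCtrl v))]

open Classical in
/-- a low cell (`j < 2d`, unrolled), contribution of one view, as expressions [folklore] -/
noncomputable def cellOpLowE (tE : GE) (j : ℕ) (ka : KA tm) (v : V tm) : List (ClOp GE) :=
  if h : j < (newWin v ka.1).length then
    (if toSym tm ka.1 ((newWin v ka.1)[j]) = ka.2 then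
      [ClOp.cnot (deltaWE tm e tE v) (cellWE tm e (.add tE (.const 1)) (.const j) ka)] else [])
  else [ClOp.toffoli (deltaWE tm e tE v)
    (cellWE tm e tE (.const (j + dd tm - (newWin v ka.1).length)) ka)
    (cellWE tm e (.add tE (.const 1)) (.const j) ka)]

/-- a high cell (`j = 2d + j'`, always a copy), contribution of one view, as expressions
[folklore] -/
noncomputable def cellOpHighE (tE jE : GE) (ka : KA tm) (v : V tm) : List (ClOp GE) :=
  [ClOp.toffoli (deltaWE tm e tE v)
    (cellWE tm e tE (.add jE (.const (3 * dd tm - (newWin v ka.1).length))) ka)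
    (cellWE tm e (.add tE (.const 1)) (.add (.const (2 * dd tm)) jE) ka)]

/-- a phantom cell, as expressions [folklore] -/
noncomputable def phantomE (tE jE : GE) : List (ClOp GE) :=
  (kList tm).map fun k => ClOp.not (cellWE tm e (.add tE (.const 1)) jE ⟨k, none⟩)

/-- **the generator of one simulation step** (chains, controls, low cells unrolled, high cells
and phantom cells by loops over `j`) [folklore] -/
noncomputable def stepG : GS :=
  .seq (seqs ((vList tm).map fun v => opsG (chainOpsE tm e (.var .tt) v)))
  (.seq (seqs ((vList tm).map fun v => opsG (ctrlOpsE tm e (.var .tt) v)))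
  (.seq (seqs ((List.range (2 * dd tm)).map fun j => seqs ((kaList tm).map fun ka =>
    seqs ((vList tm).map fun v => opsG (cellOpLowE tm e (.var .tt) j ka v)))))
  (.seq (.loop .jj (.add (.var .xn) (.mul (.const (dd tm)) (TnE e)))
    (seqs ((kaList tm).map fun ka => seqs ((vList tm).map fun v =>
      opsG (cellOpHighE tm e (.var .tt) (.var .jj) ka v)))))
  (.loop .jj (.const (dd tm)) (opsG (phantomE tm e (.var .tt) (.add (SnE tm e) (.var .jj))))))))

variable (M : TM2ComputableAux Bool Bool)

/-- writing input bit `j`, as expressions [folklore] -/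
noncomputable def inCellE (jE : GE) : List (ClOp GE) :=
  [ClOp.cnot jE (cellWE M.tm e (.const 0) jE ⟨M.tm.k₀, some (symIn M true)⟩),
    ClOp.not (cellWE M.tm e (.const 0) jE ⟨M.tm.k₀, some (symIn M false)⟩),
    ClOp.cnot jE (cellWE M.tm e (.const 0) jE ⟨M.tm.k₀, some (symIn M false)⟩)] ++
  ((kList M.tm).filter fun k => k ≠ M.tm.k₀).map fun k => ClOp.not (cellWE M.tm e (.const 0) jE ⟨k, none⟩)

/-- an empty input cell, as expressions [folklore] -/
noncomputable def emptyCellE (jE : GE) : List (ClOp GE) :=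
  (kList tm).map fun k => ClOp.not (cellWE tm e (.const 0) jE ⟨k, none⟩)

/-- **the generator of the input layer** [folklore] -/
noncomputable def inputG : GS :=
  .seq (opsG [ClOp.not (ctrlWE M.tm e (.const 0) (some M.tm.main, M.tm.initialState))])
  (.seq (.loop .jj (.var .xn) (opsG (inCellE e M (.var .jj))))
  (.loop .jj (.add (.mul (.const (dd M.tm)) (TnE e)) (.const (3 * dd M.tm)))
    (opsG (emptyCellE M.tm e (.add (.var .xn) (.var .jj))))))

/-- **the generator of the read-out** [folklore] -/
noncomputable def outputG : GS :=
  opsG [ClOp.cnot (cellWE M.tm e (TnE e) (.const 0) (outKA M)) (ansWE M.tm e),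
    ClOp.cnot (ansWE M.tm e) (.const 0), ClOp.cnot (.const 0) (ansWE M.tm e), ClOp.cnot (ansWE M.tm e) (.const 0)]

/-- **the generator of the header** `dbl (bin n) ++ 01 ++ 1^{2 ancN} ++ 01` [folklore] -/
noncomputable def headerG : GS :=
  .seq (ticksG (.var .xn)) (.seq (.emit (Tok.dump false true :: litT [false, true]))
    (.seq (.loop .uu (.mul (.const 2) (ancNE M.tm e)) (.emit [Tok.lit true])) (.emit (litT [false, true]))))

/-- **The generator program of the tableau family `revFamily e M`.** [Arora–Barak 2009, §6.2
and proof of Thm. 6.15] [folklore] -/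
noncomputable def descG : GS :=
  .seq (headerG e M) (.seq (inputG e M) (.seq (.loop .tt (TnE e) (stepG M.tm e)) (outputG e M)))

end GadgetsE

/-! ### The generated stream is the description -/

section Identities

variable {tm : FinTM2} {e : ℕ}

/-- `clChain` commutes with re-indexing. [folklore] -/
theorem map_clChain {α β : Type} (f : α → β) (a : α) :
    ∀ (ls as : List α), (clChain a ls as).map (ClOp.map f) = clChain (f a) (ls.map f) (as.map f)
  | [], [] => rfl
  | [], _ :: _ => rfl
  | _ :: _, [] => rfl
  | l :: ls, a' :: as => by
    rw [clChain, List.map_cons, List.map_cons, List.map_cons, clChain, map_clChain f a' ls as]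
    rfl

variable (tm e)

/-- The chain expressions evaluate to the chain. [folklore] -/
theorem chainOpsE_eval (tE : GE) (v : V tm) (env : GV → ℕ) :
    (chainOpsE tm e tE v).map (ClOp.map (GExpr.eval env)) = chainOps tm e (env .xn) (tE.eval env) v := by
  rw [chainOpsE, map_clChain, chainOps]
  congr 1
  · simp
  · simp only [litsE, lits, List.map_flatMap, List.map_map]
    congr 1
    funext m
    congr 1
    funext k
    simp
  · simp only [ancsE, ancs, List.map_map]
    congr 1
    funext m
    simp

/-- The control expressions evaluate to the control gadget. [folklore] -/
theorem ctrlOpsE_eval (tE : GE) (v : V tm) (env : GV → ℕ) :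
    (ctrlOpsE tm e tE v).map (ClOp.map (GExpr.eval env)) = ctrlOps tm e (env .xn) (tE.eval env) v := by
  simp [ctrlOpsE, ctrlOps, ClOp.map]

/-- The low-cell expressions evaluate to `cellOp`. [folklore] -/
theorem cellOpLowE_eval (tE : GE) (j : ℕ) (ka : KA tm) (v : V tm) (env : GV → ℕ) :
    (cellOpLowE tm e tE j ka v).map (ClOp.map (GExpr.eval env)) = cellOp tm e (env .xn) (tE.eval env) j ka v := by
  unfold cellOpLowE cellOp
  by_cases h : j < (newWin v ka.1).length
  · by_cases h2 : toSym tm ka.1 ((newWin v ka.1)[j]) = ka.2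
    · simp [h, h2, ClOp.map]
    · simp [h, h2]
  · simp [h, ClOp.map]

/-- The high-cell expressions evaluate to `cellOp` at `2d + j`. [folklore] -/
theorem cellOpHighE_eval (tE jE : GE) (ka : KA tm) (v : V tm) (env : GV → ℕ) :
    (cellOpHighE tm e tE jE ka v).map (ClOp.map (GExpr.eval env)) =
      cellOp tm e (env .xn) (tE.eval env) (2 * dd tm + jE.eval env) ka v := by
  have hlen : (newWin v ka.1).length ≤ 2 * dd tm - 1 := len_le (depth_lt_dd tm) v ka.1
  have h1 := one_le_dd tm
  unfold cellOpHighE cellOp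
  rw [dif_neg (by omega)]
  simp only [List.map_cons, List.map_nil, ClOp.map, eval_deltaWE, eval_cellWE, GExpr.eval]
  congr 3
  omega

/-- The phantom expressions evaluate to the phantom gadget. [folklore] -/
theorem phantomE_eval (tE jE : GE) (env : GV → ℕ) :
    (phantomE tm e tE jE).map (ClOp.map (GExpr.eval env)) = phantomOps tm e (env .xn) (tE.eval env) (jE.eval env) := by
  simp [phantomE, phantomOps, ClOp.map, List.map_map, Function.comp_def]

/-- `Sn = 2d + (n + d T)`. [folklore] -/
theorem Sn_eq (n : ℕ) : Sn tm e n = 2 * dd tm + (n + dd tm * Tn e n) := by simp only [Sn]; ring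

/-- `flatMap` over a shifted range. [folklore] -/
theorem flatMap_range' {α : Type} (s m : ℕ) (f : ℕ → List α) :
    (List.range' s m).flatMap f = (List.range m).flatMap fun k => f (s + k) := by
  rw [List.range'_eq_map_range, List.flatMap_map]

/-- `flatMap` over a split range. [folklore] -/
theorem flatMap_range_add {α : Type} (a b : ℕ) (f : ℕ → List α) :
    (List.range (a + b)).flatMap f = (List.range a).flatMap f ++ (List.range b).flatMap fun k => f (a + k) := by
  rw [List.range_add, List.flatMap_append, List.flatMap_map]

/-- **The step generator prints the step.** [folklore] -/
theorem out_stepG (env : GV → ℕ) :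
    (stepG tm e).out env = (stepOps tm e (env .xn) (env .tt)).flatMap opToks := by
  have hxj : ∀ j, Function.update env GV.jj j GV.xn = env .xn := fun j => by simp
  have htj : ∀ j, Function.update env GV.jj j GV.tt = env .tt := fun j => by simp
  simp only [stepG, GStmt.out, out_seqs, List.flatMap_map, out_opsG, chainOpsE_eval, ctrlOpsE_eval,
    cellOpLowE_eval, cellOpHighE_eval, phantomE_eval, GExpr.eval, hxj, htj, Function.update_self,
    eval_TnE, eval_SnE, stepOps, restOps, cellOps, List.flatMap_append, List.flatMap_assoc]
  rw [Sn_eq, flatMap_range_add (2 * dd tm), flatMap_range']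
  simp only [List.append_assoc]

variable (M : TM2ComputableAux Bool Bool)

/-- The input-cell expressions evaluate to `inCell`. [folklore] -/
theorem inCellE_eval (jE : GE) (env : GV → ℕ) :
    (inCellE e M jE).map (ClOp.map (GExpr.eval env)) = inCell e M (env .xn) (jE.eval env) := by
  simp [inCellE, inCell, ClOp.map, List.map_map, Function.comp_def]

/-- The empty-cell expressions evaluate to `emptyCell`. [folklore] -/
theorem emptyCellE_eval (jE : GE) (env : GV → ℕ) :
    (emptyCellE tm e jE).map (ClOp.map (GExpr.eval env)) = emptyCell tm e (env .xn) (jE.eval env) := by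
  simp [emptyCellE, emptyCell, ClOp.map, List.map_map, Function.comp_def]

/-- `Sn + d - n = d T + 3d`. [folklore] -/
theorem Sn_add_sub (n : ℕ) : Sn tm e n + dd tm - n = dd tm * Tn e n + 3 * dd tm := by simp only [Sn]; omega

/-- **The input generator prints the input layer.** [folklore] -/
theorem out_inputG (env : GV → ℕ) :
    (inputG e M).out env = (inputOps e M (env .xn)).flatMap opToks := by
  have hxj : ∀ j, Function.update env GV.jj j GV.xn = env .xn := fun j => by simp
  simp only [inputG, GStmt.out, out_opsG, inCellE_eval, emptyCellE_eval, GExpr.eval, hxj,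
    Function.update_self, eval_TnE, inputOps, List.flatMap_append, List.map_cons, List.map_nil, ClOp.map,
    eval_ctrlWE, List.flatMap_assoc]
  rw [flatMap_range', Sn_add_sub]

/-- **The output generator prints the read-out.** [folklore] -/
theorem out_outputG (env : GV → ℕ) :
    (outputG e M).out env = (outputOps e M (env .xn)).flatMap opToks := by
  simp [outputG, outputOps, ClOp.map]

/-- The header tokens. [folklore] -/
def headerToks (n m : ℕ) : List Tok :=
  List.replicate n Tok.tick ++ (Tok.dump false true :: litT [false, true]) ++
    (List.replicate (2 * m) (Tok.lit true) ++ litT [false, true])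

/-- **The header generator prints the header tokens.** [folklore] -/
theorem out_headerG (env : GV → ℕ) :
    (headerG e M).out env = headerToks (env .xn) (ancN M.tm e (env .xn)) := by
  simp [headerG, GStmt.out, headerToks, flatMap_range_const]

/-- **The generator prints the header followed by the tokens of the whole program.**
[folklore] -/
theorem out_descG (n : ℕ) :
    (descG e M).out (GenProg.initEnv .xn n) = headerToks n (ancN M.tm e n) ++ (allOps e M n).flatMap opToks := by
  have hxt : ∀ t, Function.update (GenProg.initEnv GV.xn n) GV.tt t GV.xn = n := fun t => by simp
  simp only [descG, GStmt.out, out_headerG, out_inputG, out_stepG, out_outputG, GenProg.initEnv_self,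
    eval_TnE, hxt, Function.update_self, allOps, List.flatMap_append, List.flatMap_assoc]

/-- The header renders to the `sigmaEncode` header. [folklore] -/
theorem render_headerToks (n m : ℕ) (B : List Tok) :
    Tok.render 0 (headerToks n m ++ B) =
      dbl (encodeNat n) ++ [false, true] ++ (List.replicate (2 * m) true ++ [false, true]) ++ Tok.render 0 B := by
  rw [headerToks, List.append_assoc, List.append_assoc, List.cons_append, Tok.render_numeral,
    show List.replicate (2 * m) (Tok.lit true) = litT (List.replicate (2 * m) true) by simp [litT],
    render_litT, List.append_assoc, render_litT, render_litT, dbl_encodeNat]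
  simp [List.append_assoc]

/-- **The description of the `n`-th circuit of the tableau family is the concatenation of the
`opBits` of the program `allOps`.** [Arora–Barak 2009, §6.1] [folklore] -/
theorem encode_revFamily_circ (n : ℕ) :
    QCircuit.encode ((revFamily e M).circ n) = (allOps e M n).flatMap opBits := by
  change QCircuit.encode (⟨revCompile (revProg e M n)⟩ : QCircuit cliffordT (NN e M n)) = _
  rw [encode_eq_flatMap]
  exact flatMap_gateEnc_revCompile_toRevList (NN_pos e M n) (allOps e M n) (allOps_lt_NN e M) (opsFin_wf e M n)

/-- **The generator renders the description of the tableau family**: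
`render 0 (out descG (x₀ ↦ n)) = sigmaEncode ⟨n, ancN n, (revFamily e M).circ n⟩`.
[Arora–Barak 2009, §6.2 and proof of Thm. 6.15] [folklore] -/
theorem render_out_descG (n : ℕ) :
    Tok.render 0 ((descG e M).out (GenProg.initEnv .xn n)) =
      QCircuit.sigmaEncode ⟨n, (revFamily e M).ancillas n, (revFamily e M).circ n⟩ := by
  rw [out_descG, render_headerToks, ← List.append_nil ((allOps e M n).flatMap opToks),
    render_flatMap_opToks, Tok.render_nil, List.append_nil, ← encode_revFamily_circ]
  change _ = boolPair (encodeNat n) (boolPair (unaryEncodeNat (ancN M.tm e n)) (QCircuit.encode ((revFamily e M).circ n)))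
  rw [boolPair_eq, boolPair_eq, RevDesc.unaryEncodeNat_eq_replicate, dbl_replicate]
  simp

/-! ### Loop-variable hygiene of the generator -/

/-- All loop variables of a statement satisfy `P`. [folklore] -/
def LV (P : GV → Prop) (s : GS) : Prop := ∀ x ∈ s.loopVars, P x

variable {P : GV → Prop}

/-- `LV` for an emission. [folklore] -/
theorem lv_emit (ts : List Tok) : LV P (.emit ts) := fun x hx => by simp [GStmt.loopVars] at hx
/-- `LV` for a sequence. [folklore] -/
theorem lv_seq {a b : GS} (ha : LV P a) (hb : LV P b) : LV P (.seq a b) := fun x hx => by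
  simp only [GStmt.loopVars, List.mem_append] at hx
  exact hx.elim (ha x) (hb x)
/-- `LV` for a loop. [folklore] -/
theorem lv_loop {i : GV} {c : GE} {body : GS} (hi : P i) (hb : LV P body) : LV P (.loop i c body) := fun x hx => by
  simp only [GStmt.loopVars, List.mem_cons] at hx
  exact hx.elim (fun h => h ▸ hi) (hb x)
/-- `LV` for `seqs`. [folklore] -/
theorem lv_seqs {l : List GS} (h : ∀ s ∈ l, LV P s) : LV P (seqs l) := fun x hx => by
  simp only [loopVars_seqs, List.mem_flatMap] at hx
  obtain ⟨s, hs, hx⟩ := hx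
  exact h s hs x hx
/-- `LV` for `seqs` of a mapped list. [folklore] -/
theorem lv_seqs_map {α : Type} {l : List α} {f : α → GS} (h : ∀ a, LV P (f a)) : LV P (seqs (l.map f)) :=
  lv_seqs fun s hs => by obtain ⟨a, _, rfl⟩ := List.mem_map.1 hs; exact h a
/-- `LV` for `opsG`: only the tick counter. [folklore] -/
theorem lv_opsG (hP : P .ii) (ops : List (ClOp GE)) : LV P (opsG ops) := fun x hx =>
  (loopVars_opsG_sub ops x hx) ▸ hP

/-- Non-reuse for a loop from `LV`. [folklore] -/
theorem noReuse_loop_of {i : GV} {c : GE} {body : GS} (h1 : LV (· ≠ i) body) (h2 : body.noReuse = true) :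
    (GStmt.loop i c body).noReuse = true := by
  rw [GStmt.noReuse, h2, Bool.and_true, decide_eq_true_iff]
  exact fun h => h1 i h rfl
/-- Non-reuse for a sequence. [folklore] -/
theorem noReuse_seq_of {a b : GS} (ha : a.noReuse = true) (hb : b.noReuse = true) : (GStmt.seq a b).noReuse = true := by
  rw [GStmt.noReuse, ha, hb, Bool.and_self]
/-- Non-reuse for `seqs` of a mapped list. [folklore] -/
theorem noReuse_seqs_map {α : Type} {l : List α} {f : α → GS} (h : ∀ a, (f a).noReuse = true) :
    (seqs (l.map f)).noReuse = true :=
  noReuse_seqs _ fun s hs => by obtain ⟨a, _, rfl⟩ := List.mem_map.1 hs; exact h a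

/-- The loop variables of the step generator. [folklore] -/
theorem lv_stepG (hi : P .ii) (hj : P .jj) : LV P (stepG tm e) :=
  lv_seq (lv_seqs_map fun _ => lv_opsG hi _) (lv_seq (lv_seqs_map fun _ => lv_opsG hi _)
    (lv_seq (lv_seqs_map fun _ => lv_seqs_map fun _ => lv_seqs_map fun _ => lv_opsG hi _)
    (lv_seq (lv_loop hj (lv_seqs_map fun _ => lv_seqs_map fun _ => lv_opsG hi _)) (lv_loop hj (lv_opsG hi _)))))

/-- The step generator does not reuse loop variables. [folklore] -/
theorem noReuse_stepG : (stepG tm e).noReuse = true :=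
  noReuse_seq_of (noReuse_seqs_map fun _ => noReuse_opsG _) (noReuse_seq_of (noReuse_seqs_map fun _ => noReuse_opsG _)
    (noReuse_seq_of (noReuse_seqs_map fun _ => noReuse_seqs_map fun _ => noReuse_seqs_map fun _ => noReuse_opsG _)
    (noReuse_seq_of (noReuse_loop_of (lv_seqs_map fun _ => lv_seqs_map fun _ => lv_opsG (by decide) _)
      (noReuse_seqs_map fun _ => noReuse_seqs_map fun _ => noReuse_opsG _))
      (noReuse_loop_of (lv_opsG (by decide) _) (noReuse_opsG _)))))

/-- The loop variables of the input generator. [folklore] -/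
theorem lv_inputG (hi : P .ii) (hj : P .jj) : LV P (inputG e M) :=
  lv_seq (lv_opsG hi _) (lv_seq (lv_loop hj (lv_opsG hi _)) (lv_loop hj (lv_opsG hi _)))

/-- The input generator does not reuse loop variables. [folklore] -/
theorem noReuse_inputG : (inputG e M).noReuse = true :=
  noReuse_seq_of (noReuse_opsG _) (noReuse_seq_of (noReuse_loop_of (lv_opsG (by decide) _) (noReuse_opsG _))
    (noReuse_loop_of (lv_opsG (by decide) _) (noReuse_opsG _)))

/-- The loop variables of the header generator. [folklore] -/
theorem lv_headerG (hi : P .ii) (hu : P .uu) : LV P (headerG e M) :=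
  lv_seq (lv_loop hi (lv_emit _)) (lv_seq (lv_emit _) (lv_seq (lv_loop hu (lv_emit _)) (lv_emit _)))

/-- The loop variables of the whole generator are `t, j, i, u`. [folklore] -/
theorem lv_descG : LV (· ≠ GV.xn) (descG e M) :=
  lv_seq (lv_headerG e M (by decide) (by decide)) (lv_seq (lv_inputG e M (by decide) (by decide))
    (lv_seq (lv_loop (by decide) (lv_stepG M.tm e (by decide) (by decide))) (lv_opsG (by decide) _)))

/-- The loop variables of the generator avoid the input variable. [folklore] -/
theorem xn_not_mem_loopVars_descG : GV.xn ∉ (descG e M).loopVars := fun h => lv_descG e M _ h rfl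

/-- The generator does not reuse loop variables. [folklore] -/
theorem noReuse_descG : (descG e M).noReuse = true :=
  noReuse_seq_of (noReuse_seq_of rfl (noReuse_seq_of rfl (noReuse_seq_of rfl rfl)))
    (noReuse_seq_of (noReuse_inputG e M) (noReuse_seq_of
      (noReuse_loop_of (lv_stepG M.tm e (by decide) (by decide)) (noReuse_stepG M.tm e)) (noReuse_opsG _)))

/-! ### Uniformity -/

/-- **Uniformity bridge.** A circuit family is polynomial-time uniform as soon as the string
function `z ↦ sigmaEncode ⟨|z|, ancillas |z|, circ |z|⟩ (which on the unary input `1ⁿ` is the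
description of the `n`-th circuit) lies in `FP`: `QCircuitFamily.IsUniform` only constrains the
machine on the inputs `1ⁿ = unaryEncodeNat n`, of length `n`. [Arora–Barak 2009, §6.2
(P-uniform circuit families: "there is a polynomial-time TM that on input `1ⁿ` outputs the
description of the circuit `Cₙ`"); Nielsen–Chuang 2010, §4.5.5] This is the statement
`QCircuitFamily.isUniform_of_descFn_mem_FP` of `Cryptography/QuantumCircuitDescFP.lean` with the
description function `QCircuitFamily.descFn` unfolded and `F` explicit; it is proved through that
lemma and kept under this name for its callers (prefer `isUniform_of_descFn_mem_FP`).
[cite: AroraBarak2009, §6.2] -/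
theorem _root_.Literature.Computability.Cryptography.QCircuitFamily.isUniform_of_mem_FP {G : QGateSet} [Encodable G.Op]
    (F : QCircuitFamily G)
    (h : (fun z : List Bool =>
      QCircuit.sigmaEncode (G := G) ⟨z.length, F.ancillas z.length, F.circ z.length⟩) ∈ FP) :
    F.IsUniform :=
  QCircuitFamily.isUniform_of_descFn_mem_FP h

/-- **Uniformity of the tableau family.** The family `revFamily e M` (input layer, `T(n)`
reversible simulation steps, read-out, compiled to Clifford+T) is polynomial-time uniform: its
description `sigmaEncode ⟨n, ancN n, circ n⟩` is rendered by the generator program `descG`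
(nested counted loops with polynomial bounds, wire indices as binary numerals of unary-counted
affine expressions), hence computed from `1ⁿ` in polynomial time
(`GStmt.render_out_mem_FP`, `QCircuitFamily.isUniform_of_mem_FP`). [Arora–Barak 2009, §6.2,
Thm. 6.6 and proof of Thm. 6.15; Bernstein–Vazirani 1997, Thm. 8.2 (proof)]
[cite: AroraBarak2009, §6.2 Thm. 6.15 (proof)] -/
theorem revFamily_isUniform : (revFamily e M).IsUniform := by
  refine QCircuitFamily.isUniform_of_mem_FP _ ?_
  have h := GStmt.render_out_mem_FP (descG e M) .xn (xn_not_mem_loopVars_descG e M) (noReuse_descG e M)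
  have e1 : (fun z : List Bool => Tok.render 0 ((descG e M).out (GenProg.initEnv .xn z.length))) =
      fun z : List Bool => QCircuit.sigmaEncode (G := cliffordT)
        ⟨z.length, (revFamily e M).ancillas z.length, (revFamily e M).circ z.length⟩ := by
    funext z; exact render_out_descG e M z.length
  rw [e1] at h
  exact h

end Identities

end RevSim

end Literature.Computability.QuantumComplexity
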